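import Summits.NavierStokesRegularity.NavierStokesRegularity.Theorems.ExtremiserTransienceWeakClassTypeIAncientMild
import Summits.NavierStokesRegularity.NavierStokesRegularity.Theorems.ExtremiserTransienceWeakClassPressureSource
import Literature.Analysis.FluidPDE.OseenMildPressureIdentification
import HarnessLib

/-!
# Route `ExtremiserTransience`, LINE g5-α repair (seat ns-idea-5 g5): the pressure of a weak-class field IS the Riesz pressure modulo constants

`--supports stmt-NavierStokesRegularity-27823` (the subcubic local energy budget, p639422) — recipe steps 1–2 of the line card §RECIPE, DONE.
Route-independent module.  For a member `(W, K)` of the weak one-slice class and every `t₀ < 0` there is a smooth pressure `q` with `(W, q)` a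
classical unit-viscosity Navier–Stokes solution on `(t₀, 0)` (`weakClass_exists_classical_window`, p639292) AND, at every time `σ ∈ (t₀, 0)` and for
every base point `x₀`, `q(σ, ·) = pressurePotentialMod x₀ (W σ) + c(σ)` (the tree's `pressure_eq_pressurePotentialMod_add_const_of_oseenMild`,
KNSS 2009 §4 / Seregin 2014 Rem. 6.4, on the window `(t₀, σ/2)`: sup bound `K/√(−σ/2)`, pressure-source bound `weakClass_pressureSource_window`
(p639898), Oseen identity in `heatExtension` form).  What remains of the 27823 budget after this file: the integrated local energy identity
`IsClassicalNSSolutionOn.local_energy_identity_cutoff` for `(W, q)` with a ball cutoff and the four elementary estimates of §RECIPE step 4 (pressure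
via `exists_abs_pressurePotentialMod_sub_le`, giving `O(ρ^{5/2})`).  HONEST FRAMING: regularity bookkeeping for hypothetical blow-up limits; nothing
about Navier–Stokes regularity or blow-up is proved here and no summit is proved by a line.
[cite: KochNadirashviliSereginSverak2009, §4 p. 8 (arXiv:0709.3599)]
-/

noncomputable section

namespace Summit.NavierStokesRegularity.NavierStokesRegularity.Theorems.ExtremiserTransience
set_option linter.dupNamespace false

open Set Function MeasureTheory Filter Topology
open scoped RealInnerProductSpace ContDiff
open Literature.Analysis Literature.Analysis.FluidPDE

/-- **Classical pressure = Riesz pressure mod constants, on every window, for weak-class fields.** [cite: KochNadirashviliSereginSverak2009, §4 p. 8 (arXiv:0709.3599)] -/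
theorem weakClass_pressure_window (W : ℝ → EuclideanSpace ℝ (Fin 3) → EuclideanSpace ℝ (Fin 3)) (K : ℝ)
    (hcont : ContinuousOn (Function.uncurry W) (Set.Iio (0 : ℝ) ×ˢ Set.univ))
    (hmild : ∀ s t : ℝ, s < t → t < 0 → ∀ x, W t x =
      Literature.Analysis.FluidPDE.heatFlow (W s) (t - s) x - Literature.Analysis.FluidPDE.oseenDuhamel 1 s W W t x)
    (hdec : ∀ t : ℝ, t < 0 → ∀ x, Real.sqrt (-t) * ‖W t x‖ ≤ K) {t₀ : ℝ} (ht₀ : t₀ < 0) :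
    ∃ q : ℝ → EuclideanSpace ℝ (Fin 3) → ℝ, IsClassicalNSSolutionOn (Set.Ioo t₀ 0) 1 0 W q ∧
      ∀ σ ∈ Set.Ioo t₀ 0, ∀ x₀ : EuclideanSpace ℝ (Fin 3), ∃ c : ℝ, ∀ x, q σ x = pressurePotentialMod x₀ (W σ) x + c := by
  obtain ⟨q, hq⟩ := weakClass_exists_classical_window W K hcont hmild hdec ht₀
  obtain ⟨KG, hKG, hG⟩ := weakClass_pressureSource_window W K hcont hmild hdec
  have hK : 0 ≤ K := by
    have h := hdec (-1) (by norm_num) 0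
    have h1 : Real.sqrt (-(-1 : ℝ)) = 1 := by norm_num
    rw [h1, one_mul] at h
    exact (norm_nonneg _).trans h
  refine ⟨q, hq, fun σ hσ x₀ => ?_⟩
  -- the window `(t₀, σ/2) ∋ σ`
  set t₂ : ℝ := σ / 2 with ht₂
  have hσ0 : σ < 0 := hσ.2
  have ht₂0 : t₂ < 0 := by rw [ht₂]; linarith
  have hσt₂ : σ < t₂ := by rw [ht₂]; linarith
  have hsub : Ioo t₀ t₂ ⊆ Ioo t₀ 0 := fun τ hτ => ⟨hτ.1, hτ.2.trans ht₂0⟩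
  have hq' : IsClassicalNSSolutionOn (Ioo t₀ t₂) 1 0 W q := hq.mono hsub isOpen_Ioo.uniqueDiffOn
  -- sup bound on the window
  have hN : ∀ τ ∈ Ioo t₀ t₂, ∀ x, ‖W τ x‖ ≤ K / Real.sqrt (-t₂) := by
    intro τ hτ x
    have hτ0 : τ < 0 := hτ.2.trans ht₂0
    have hsq : 0 < Real.sqrt (-τ) := Real.sqrt_pos.2 (by linarith)
    have h1 : ‖W τ x‖ ≤ K / Real.sqrt (-τ) := by
      rw [le_div_iff₀ hsq, mul_comm]; exact hdec τ hτ0 x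
    exact h1.trans (div_le_div_of_nonneg_left hK (Real.sqrt_pos.2 (by linarith))
      (Real.sqrt_le_sqrt (by linarith [hτ.2])))
  -- Oseen identity in `heatExtension` form on the window
  have hmildE : ∀ s ∈ Ioo t₀ t₂, ∀ t ∈ Ioo t₀ t₂, s < t → ∀ x,
      W t x = UnboundedOperators.heatExtension (W s) (t - s) x - oseenDuhamel 1 s W W t x := by
    intro s _ t ht hst x
    rw [← heatFlow_of_pos _ (sub_pos.2 hst)]
    exact hmild s t hst (ht.2.trans ht₂0) x
  exact PressureNormalisation.pressure_eq_pressurePotentialMod_add_const_of_oseenMild hq' hN (hG t₀ t₂ ht₂0) hmildE x₀ ⟨hσ.1, hσt₂⟩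

end Summit.NavierStokesRegularity.NavierStokesRegularity.Theorems.ExtremiserTransience

end
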